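import Literature.NumberTheory.ComplexMultiplication.CMOrderGorenstein
import HarnessLib

/-!
# Multiplicator rings and extension (MARSEGLIA 2025 §5): `(R:(R:T)) = (RᵗT : RᵗT)` for an over-order `T`, the four
# equivalent conditions of Prop. 5.1, `T = (𝔭:𝔭)` qualifies (Prop. 5.2), `(𝔭:𝔭) ⊆ T` for `𝔭 ⊇ (R:T)` (Prop. 5.3);
# and Lemma 2.2: `(R:(R:𝔭)) = 𝔭`, `𝔭` singular ⟺ `(𝔭:𝔭) = (R:𝔭)`

Family `hodge`, lane `lit-hodgefound` (Track 2 foundations library; seat p15, row g26-#8), topic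
`Literature/NumberTheory/ComplexMultiplication`, namespaces `Literature.NumberTheory.ComplexMultiplication.EndOrder`
(§1: any order `𝔯 = endOrder ρ` of the series) and `…CMTypeLattice` (§2: the order `𝔯 = endOrder (M_μ)`, where trace
duals are available as in `CMOrderGorenstein`: `↑T = traceDual ℤ ℚ ↑I` says «`T = Iᵗ`»).  THEOREMS ONLY: no
definition, no instance, no named fact (net Literature debt `0`).  Vocabulary: Mathlib's `FractionalIdeal (endOrder ρ)⁰ K`
with `(I:J) = I / J`, the order itself is `1`, an over-order is an idempotent `M = MM ≠ 0`
(`CMOrderOverordersIdempotents`), «`𝔭` invertible» is `IsUnit (𝔭 : FractionalIdeal _ K)`.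

## Source, VERBATIM

S. Marseglia, *Local isomorphism classes of fractional ideals of orders in étale algebras*, J. Algebra 673 (2025)
77–102 [Marseglia2025LocalIsomorphism] (arXiv:2311.18571, held `paper:arxiv-2311.18571`).  §2, chunk p0005:
"Lemma 2.2. Let `R` be an order, `I` a fractional `R`-ideal and `𝔭` a maximal ideal of `R`. Then: … (3)
`R ⊊ (R:𝔭)`. (4) `(R:(R:𝔭)) = 𝔭`. … (6) If `𝔭` is not invertible in `R` then `(𝔭:𝔭) = (R:𝔭)`. …"
§5, chunk p0010: "Proposition 5.1. Let `R` be an order. For an overorder `R ⊆ T`, the following are equivalent: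
(1) `R^t T` has multiplicator ring `T`. (2) For every fractional `R`-ideal `I` with `(I:I) = R`, the extension `IT`
has multiplicator ring `T`. (3) `(R:(R:T)) = T`. (4) `(R:(R:T)) ⊆ T`.  Proof. Assume (1) and pick `I` such that
`(I:I) = R`. Note that `T` is contained in the multiplicator ring of `IT`, which in turn is contained in the
multiplicator ring of `IT · I^tT = R^tT`. Hence, `IT` has multiplicator ring `T` as well, which shows (2). The converse
is also true since `R^t` has multiplicator ring `R`. … By Lemma 2.1 we have
`(R:(R:T)) = (R^t(R:T))^t = (R^t(R^tT)^t)^t = (R^tT(R^tT)^t)^t`. So, (3) holds if and only if `R^tT(R^tT)^t = T^t`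
which is equivalent to (1), again by Lemma 2.1. Conditions (3) and (4) are equivalent because `T ⊆ (R:(R:T))` holds
by definition. □  Proposition 5.2. Let `R` be an order. For every maximal ideal `𝔭` of `R` the multiplicator ring
`T = (𝔭:𝔭)` satisfies the equivalent conditions of Proposition 5.1.  Proof. If `𝔭` is invertible then `(𝔭:𝔭) = R`
… Assume `𝔭` is not invertible. Then … `(R:(R:T)) = (R:(R:(R:𝔭))) = (R:𝔭) = T`. □  Proposition 5.3. Let `R` be an
order and `T` an overorder of `R` satisfying the equivalent conditions of Proposition 5.1. Then for every maximal
ideal `𝔭` of `R` containing the conductor `(R:T)`, we have `(𝔭:𝔭) ⊆ T`.  Proof. … every maximal ideal `𝔭` above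
`(R:T)` is non-invertible … by Lemma 2.2.(6) and the assumption on `T`, we have `(𝔭:𝔭) = (R:𝔭) ⊆ (R:(R:T)) = T`."

## What is formalised (the printed chain `(R^t(R^tT)^t)^t = (R^tT(R^tT)^t)^t = ((R^tT:R^tT))^{tt}` is made the
## IDENTITY `one_div_one_div_eq_mul_div_mul_of_coe_eq_traceDual`, from which (1) ⟺ (3) is a rewrite)

* §1 (`𝔯 = endOrder ρ`): `div_le_div_left_of_le` (colon is antitone), **`one_div_one_div_coeIdeal`** (Lemma 2.2 (4)),
  **`coeIdeal_div_self_eq_one_div_of_not_isUnit`**, **`not_isUnit_coeIdeal_iff_div_self_eq_one_div`** (Lemma 2.2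
  (6) and its converse), `one_div_one_div_eq_iff_le` (Prop. 5.1 (3) ⟺ (4)), **`one_div_one_div_coeIdeal_div_self`**
  (Prop. 5.2 in form (3)), **`coeIdeal_div_self_le_of_one_div_le`** (Prop. 5.3, from condition (4)).
* §2 (`𝔯 = endOrder (M_μ)`): **`one_div_one_div_eq_mul_div_mul_of_coe_eq_traceDual`** (`(R:(R:T)) = (RᵗT:RᵗT)`),
  **`mul_div_mul_eq_iff_one_div_one_div_eq`** (Prop. 5.1 (1) ⟺ (3)), `div_self_le_mul_div_mul`,
  **`forall_mul_div_mul_eq_iff`** (Prop. 5.1 (2) ⟺ (1)), `mul_div_mul_eq_of_one_div_one_div_eq` ((3) ⟹ (2)),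
  **`mul_div_mul_eq_coeIdeal_div_self`** (Prop. 5.2 in form (2)).
-/

noncomputable section

open scoped nonZeroDivisors NumberField
open NumberField Module FractionalIdeal
open Submodule (traceDual)

namespace Literature.NumberTheory.ComplexMultiplication

/-! ## §1 Every order `𝔯 = endOrder ρ`: Lemma 2.2 (4), (6), Prop. 5.1 (3) ⟺ (4), Prop. 5.2, Prop. 5.3 -/

namespace EndOrder

variable {K : Type} [Field K] [NumberField K]
variable {ι : Type} [Fintype ι] [DecidableEq ι] [Nonempty ι] {ρ : K →ₐ[ℚ] Matrix ι ι ℚ}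
variable [IsFractionRing (endOrder ρ) K]

omit [Nonempty ι] in
/-- The colon is antitone in the second variable: `J ⊆ J′ ⟹ (I:J′) ⊆ (I:J)` (`J ≠ 0`) («since `(R:T) ⊆ 𝔭`, …
`(R:𝔭) ⊆ (R:(R:T))`»). [cite: Marseglia2025LocalIsomorphism, §5, proof of Prop. 5.3, p. 10] -/
theorem div_le_div_left_of_le {I J J' : FractionalIdeal (endOrder ρ)⁰ K} (hJ : J ≠ 0) (h : J ≤ J') :
    I / J' ≤ I / J := by
  have hJ' : J' ≠ 0 := fun h' ↦ hJ (le_bot_iff.1 (le_of_le_of_eq h h'))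
  intro x hx
  rw [mem_div_iff_of_ne_zero hJ'] at hx
  rw [mem_div_iff_of_ne_zero hJ]
  exact fun y hy ↦ hx y (h hy)

/-- **LEMMA 2.2 (4): `(R:(R:𝔭)) = 𝔭` for every maximal ideal `𝔭` of an order** (`(R:(R:𝔭))` is an ideal of `R`
containing `𝔭`; it is not `R` because `R ⊊ (R:𝔭)`, Lemma 2.2 (3) = `CMOrderPrimeIdealInverse.one_lt_inv_coeIdeal`).
[cite: Marseglia2025LocalIsomorphism, §2 Lemma 2.2 (3), (4), p. 5] -/
theorem one_div_one_div_coeIdeal (𝔭 : Ideal (endOrder ρ)) [h𝔭 : 𝔭.IsMaximal] :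
    (1 : FractionalIdeal (endOrder ρ)⁰ K) / (1 / (𝔭 : FractionalIdeal (endOrder ρ)⁰ K)) = 𝔭 := by
  have h0 : 𝔭 ≠ ⊥ := Ring.ne_bot_of_isMaximal_of_not_isField h𝔭 not_isField
  have hP0 : (𝔭 : FractionalIdeal (endOrder ρ)⁰ K) ≠ 0 := coeIdeal_ne_zero.2 h0
  have hP'0 : (1 : FractionalIdeal (endOrder ρ)⁰ K) / 𝔭 ≠ 0 := div_ne_zero_of_one_le le_rfl hP0
  have h1 : (1 : K) ∈ (1 : FractionalIdeal (endOrder ρ)⁰ K) / 𝔭 :=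
    (mem_div_iff_of_ne_zero hP0).2 fun y hy ↦ by rw [one_mul]; exact coeIdeal_le_one hy
  -- `(R:(R:𝔭)) ⊆ R` is an ideal `J ⊇ 𝔭`
  have hle1 : (1 : FractionalIdeal (endOrder ρ)⁰ K) / (1 / 𝔭) ≤ 1 := fun x hx ↦ by
    have h := (mem_div_iff_of_ne_zero hP'0).1 hx 1 h1
    rwa [mul_one] at h
  obtain ⟨J, hJ⟩ := le_one_iff_exists_coeIdeal.1 hle1
  have h𝔭J : 𝔭 ≤ J := (coeIdeal_le_coeIdeal K).1 (hJ ▸ le_div_div hP'0)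
  rcases eq_or_ne J ⊤ with rfl | hJtop
  · -- `J = R` would give `(R:𝔭) ⊆ R`, against `R ⊊ (R:𝔭)`
    exfalso
    have h11 : (1 : K) ∈ (1 : FractionalIdeal (endOrder ρ)⁰ K) / (1 / 𝔭) := by
      rw [← hJ, coeIdeal_top]; exact one_mem_one _
    have hle : (1 : FractionalIdeal (endOrder ρ)⁰ K) / 𝔭 ≤ 1 := fun y hy ↦ by
      have h := (mem_div_iff_of_ne_zero hP'0).1 h11 y hy
      rwa [one_mul] at h
    have hlt := one_lt_inv_coeIdeal (K := K) h0 h𝔭.ne_top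
    rw [inv_eq] at hlt
    exact absurd hle (not_le_of_gt hlt)
  · rw [← hJ, ← h𝔭.eq_of_le hJtop h𝔭J]

/-- **LEMMA 2.2 (6): if `𝔭` is not invertible then `(𝔭:𝔭) = (R:𝔭)`** (`𝔭(R:𝔭)` is an ideal containing `𝔭`, and
it is not `R`; so `𝔭(R:𝔭) = 𝔭`). [cite: Marseglia2025LocalIsomorphism, §2 Lemma 2.2 (6), p. 5]
[cite: Stevenhagen2008NumberRings, §9 (first method: «`a` is in the multiplier ring `Λ(𝔭)` … so `𝔭` is singular»),
p. 238] -/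
theorem coeIdeal_div_self_eq_one_div_of_not_isUnit (𝔭 : Ideal (endOrder ρ)) [h𝔭 : 𝔭.IsMaximal]
    (h : ¬ IsUnit (𝔭 : FractionalIdeal (endOrder ρ)⁰ K)) :
    (𝔭 : FractionalIdeal (endOrder ρ)⁰ K) / 𝔭 = 1 / 𝔭 := by
  have h0 : 𝔭 ≠ ⊥ := Ring.ne_bot_of_isMaximal_of_not_isField h𝔭 not_isField
  have hP0 : (𝔭 : FractionalIdeal (endOrder ρ)⁰ K) ≠ 0 := coeIdeal_ne_zero.2 h0
  -- `𝔭(R:𝔭) = J` with `𝔭 ⊆ J ⊆ R`, `J ≠ R`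
  obtain ⟨J, hJ⟩ := le_one_iff_exists_coeIdeal.1
    (mul_one_div_le_one : (𝔭 : FractionalIdeal (endOrder ρ)⁰ K) * (1 / 𝔭) ≤ 1)
  have h𝔭J : 𝔭 ≤ J := (coeIdeal_le_coeIdeal K).1 (hJ ▸ le_self_mul_one_div coeIdeal_le_one)
  rcases eq_or_ne J ⊤ with rfl | hJtop
  · rw [coeIdeal_top] at hJ
    exact absurd (IsUnit.of_mul_eq_one _ hJ.symm) h
  have hmul : (𝔭 : FractionalIdeal (endOrder ρ)⁰ K) * (1 / 𝔭) = 𝔭 := by rw [← hJ, ← h𝔭.eq_of_le hJtop h𝔭J]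
  refine le_antisymm ((le_div_iff_mul_le hP0).2 (((le_div_iff_mul_le hP0).1 le_rfl).trans coeIdeal_le_one))
    ((le_div_iff_mul_le hP0).2 ?_)
  rw [mul_comm, hmul]

/-- **LEMMA 2.2 (6) with its converse: `𝔭` is NOT invertible iff `(𝔭:𝔭) = (R:𝔭)`** (if `𝔭` is invertible then
`(𝔭:𝔭) = R ⊊ (R:𝔭)`, Lemma 2.2 (2), (3)). [cite: Marseglia2025LocalIsomorphism, §2 Lemma 2.2 (2), (3), (6), p. 5] -/
theorem not_isUnit_coeIdeal_iff_div_self_eq_one_div (𝔭 : Ideal (endOrder ρ)) [h𝔭 : 𝔭.IsMaximal] :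
    ¬ IsUnit (𝔭 : FractionalIdeal (endOrder ρ)⁰ K) ↔ (𝔭 : FractionalIdeal (endOrder ρ)⁰ K) / 𝔭 = 1 / 𝔭 := by
  refine ⟨coeIdeal_div_self_eq_one_div_of_not_isUnit 𝔭, fun h hu ↦ ?_⟩
  have h0 : 𝔭 ≠ ⊥ := Ring.ne_bot_of_isMaximal_of_not_isField h𝔭 not_isField
  have hlt := one_lt_inv_coeIdeal (K := K) h0 h𝔭.ne_top
  rw [inv_eq, ← h, fractionalIdeal_div_self_of_isUnit hu] at hlt
  exact lt_irrefl _ hlt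

omit [Nonempty ι] in
/-- **PROPOSITION 5.1, (3) ⟺ (4): `(R:(R:T)) = T ⟺ (R:(R:T)) ⊆ T`** («because `T ⊆ (R:(R:T))` holds by
definition»; any `T ≠ 0`). [cite: Marseglia2025LocalIsomorphism, §5 Prop. 5.1 ((3) ⟺ (4)), p. 10] -/
theorem one_div_one_div_eq_iff_le {M : FractionalIdeal (endOrder ρ)⁰ K} (hM0 : M ≠ 0) :
    (1 : FractionalIdeal (endOrder ρ)⁰ K) / (1 / M) = M ↔ (1 : FractionalIdeal (endOrder ρ)⁰ K) / (1 / M) ≤ M :=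
  ⟨le_of_eq, fun h ↦ le_antisymm h (le_div_div (div_ne_zero_of_one_le le_rfl hM0))⟩

/-- **PROPOSITION 5.2 (in form (3)): the multiplicator ring `T = (𝔭:𝔭)` of a maximal ideal satisfies
`(R:(R:T)) = T`** («If `𝔭` is invertible then `(𝔭:𝔭) = R` … Assume `𝔭` is not invertible. Then
`(R:(R:T)) = (R:(R:(R:𝔭))) = (R:𝔭) = T`»). [cite: Marseglia2025LocalIsomorphism, §5 Prop. 5.2, p. 10] -/
theorem one_div_one_div_coeIdeal_div_self (𝔭 : Ideal (endOrder ρ)) [𝔭.IsMaximal] :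
    (1 : FractionalIdeal (endOrder ρ)⁰ K) / (1 / ((𝔭 : FractionalIdeal (endOrder ρ)⁰ K) / 𝔭)) =
      (𝔭 : FractionalIdeal (endOrder ρ)⁰ K) / 𝔭 := by
  by_cases hu : IsUnit (𝔭 : FractionalIdeal (endOrder ρ)⁰ K)
  · rw [fractionalIdeal_div_self_of_isUnit hu, FractionalIdeal.div_one, FractionalIdeal.div_one]
  · rw [coeIdeal_div_self_eq_one_div_of_not_isUnit 𝔭 hu, one_div_one_div_coeIdeal 𝔭]

/-- **PROPOSITION 5.3: if the over-order `T = M` satisfies `(R:(R:T)) ⊆ T` (Prop. 5.1 (4)), then `(𝔭:𝔭) ⊆ T` for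
every maximal `𝔭 ⊇ (R:T)`** (invertible `𝔭`: `(𝔭:𝔭) = R ⊆ T`; otherwise `(𝔭:𝔭) = (R:𝔭) ⊆ (R:(R:T)) ⊆ T`).
[cite: Marseglia2025LocalIsomorphism, §5 Prop. 5.3, p. 10] -/
theorem coeIdeal_div_self_le_of_one_div_le {M : FractionalIdeal (endOrder ρ)⁰ K} (hMM : M * M = M) (hM0 : M ≠ 0)
    (hM : (1 : FractionalIdeal (endOrder ρ)⁰ K) / (1 / M) ≤ M) (𝔭 : Ideal (endOrder ρ)) [𝔭.IsMaximal]
    (h𝔭 : (1 : FractionalIdeal (endOrder ρ)⁰ K) / M ≤ 𝔭) :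
    (𝔭 : FractionalIdeal (endOrder ρ)⁰ K) / 𝔭 ≤ M := by
  by_cases hu : IsUnit (𝔭 : FractionalIdeal (endOrder ρ)⁰ K)
  · rw [fractionalIdeal_div_self_of_isUnit hu]
    exact one_le_of_mul_self_eq hMM hM0
  · rw [coeIdeal_div_self_eq_one_div_of_not_isUnit 𝔭 hu]
    exact (div_le_div_left_of_le (div_ne_zero_of_one_le le_rfl hM0) h𝔭).trans hM

end EndOrder

/-! ## §2 The order `𝔯 = endOrder (M_μ)`: `(R:(R:T)) = (RᵗT : RᵗT)` and Proposition 5.1 -/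

namespace CMTypeLattice

variable {K : Type} [Field K] [NumberField K]
variable {ι : Type} [Fintype ι] [DecidableEq ι] [Nonempty ι] (μ : Basis ι ℚ K)
variable [IsFractionRing (endOrder (Algebra.leftMulMatrix μ)) K]

/-- **`(R:(R:T)) = (RᵗT : RᵗT)` for every over-order `T = M` of `R = endOrder (M_μ)`** (`↑T₁ = Rᵗ`): the printed
chain `(R:(R:T)) = (Rᵗ(R:T))ᵗ = (Rᵗ(RᵗT)ᵗ)ᵗ = (RᵗT(RᵗT)ᵗ)ᵗ` (Lemma 2.1; `(RᵗT)ᵗ = (R:T)` is a `T`-module), closed by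
Lemma 2.3's `NNᵗ = (N:N)ᵗ` and `ᵗᵗ = id` for `N = RᵗT`. [cite: Marseglia2025LocalIsomorphism, §5, proof of Prop. 5.1,
p. 10] [cite: Marseglia2019, §2 Lemma 2.3, p. 4] -/
theorem one_div_one_div_eq_mul_div_mul_of_coe_eq_traceDual
    {M T₁ : FractionalIdeal (endOrder (Algebra.leftMulMatrix μ))⁰ K} (hMM : M * M = M) (hM0 : M ≠ 0)
    (hT₁ : (T₁ : Submodule (endOrder (Algebra.leftMulMatrix μ)) K) =
      traceDual ℤ ℚ ((1 : FractionalIdeal (endOrder (Algebra.leftMulMatrix μ))⁰ K) :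
        Submodule (endOrder (Algebra.leftMulMatrix μ)) K)) :
    (1 : FractionalIdeal (endOrder (Algebra.leftMulMatrix μ))⁰ K) / (1 / M) = T₁ * M / (T₁ * M) := by
  -- `T₁ ≠ 0`
  have h10 : (1 : FractionalIdeal (endOrder (Algebra.leftMulMatrix μ))⁰ K) ≠ 0 := one_ne_zero
  obtain ⟨T, hT0, hT⟩ := exists_coe_eq_traceDual μ h10
  have hTT₁ : T = T₁ := coeToSubmodule_inj.1 (hT.trans hT₁.symm)
  subst hTT₁
  have h1M0 : (1 : FractionalIdeal (endOrder (Algebra.leftMulMatrix μ))⁰ K) / M ≠ 0 :=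
    EndOrder.div_ne_zero_of_one_le le_rfl hM0
  have hN0 : T * M ≠ 0 := EndOrder.fractionalIdeal_mul_ne_zero hT0 hM0
  -- `(R:T) = (RᵗT)ᵗ`, `(R:(R:T)) = (Rᵗ(R:T))ᵗ`
  have hN : (((1 : FractionalIdeal (endOrder (Algebra.leftMulMatrix μ))⁰ K) / M :
      FractionalIdeal (endOrder (Algebra.leftMulMatrix μ))⁰ K) : Submodule (endOrder (Algebra.leftMulMatrix μ)) K) =
        traceDual ℤ ℚ ((T * M : FractionalIdeal (endOrder (Algebra.leftMulMatrix μ))⁰ K) :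
          Submodule (endOrder (Algebra.leftMulMatrix μ)) K) :=
    coe_div_eq_traceDual_mul μ h10 hM0 hT
  have hD : (((1 : FractionalIdeal (endOrder (Algebra.leftMulMatrix μ))⁰ K) / (1 / M) :
      FractionalIdeal (endOrder (Algebra.leftMulMatrix μ))⁰ K) : Submodule (endOrder (Algebra.leftMulMatrix μ)) K) =
        traceDual ℤ ℚ ((T * (1 / M) : FractionalIdeal (endOrder (Algebra.leftMulMatrix μ))⁰ K) :
          Submodule (endOrder (Algebra.leftMulMatrix μ)) K) :=
    coe_div_eq_traceDual_mul μ h10 h1M0 hT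
  -- `(R:T) = (RᵗT)ᵗ` is a `T`-module: `T·(R:T) = (R:T)`
  have hMN : M * (T * M) = T * M := by rw [mul_left_comm, hMM]
  have hM1 : (1 : K) ∈ M := FractionalIdeal.one_le.1 (EndOrder.one_le_of_mul_self_eq hMM hM0)
  have hMD : M * (1 / M) = 1 / M := mul_eq_of_coe_eq_traceDual μ hMN hM1 hN
  have hkey : T * (1 / M) = T * M * (1 / M) := by rw [mul_assoc, hMD]
  -- `(NNᵗ)ᵗ = (N:N)` for `N = RᵗT`
  apply coeToSubmodule_inj.1
  rw [hD, hkey, traceDual_coe_mul_eq_coe_div_self μ hN0 hN]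

/-- **PROPOSITION 5.1, (1) ⟺ (3): `(RᵗT : RᵗT) = T ⟺ (R:(R:T)) = T`** (`T = M` an over-order, `↑T₁ = Rᵗ`).
[cite: Marseglia2025LocalIsomorphism, §5 Prop. 5.1 ((1) ⟺ (3)), p. 10] -/
theorem mul_div_mul_eq_iff_one_div_one_div_eq
    {M T₁ : FractionalIdeal (endOrder (Algebra.leftMulMatrix μ))⁰ K} (hMM : M * M = M) (hM0 : M ≠ 0)
    (hT₁ : (T₁ : Submodule (endOrder (Algebra.leftMulMatrix μ)) K) =
      traceDual ℤ ℚ ((1 : FractionalIdeal (endOrder (Algebra.leftMulMatrix μ))⁰ K) :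
        Submodule (endOrder (Algebra.leftMulMatrix μ)) K)) :
    T₁ * M / (T₁ * M) = M ↔ (1 : FractionalIdeal (endOrder (Algebra.leftMulMatrix μ))⁰ K) / (1 / M) = M := by
  rw [one_div_one_div_eq_mul_div_mul_of_coe_eq_traceDual μ hMM hM0 hT₁]

omit [Nonempty ι] in
/-- «`T` is contained in the multiplicator ring of `IT`, which in turn is contained in the multiplicator ring of
`IT · IᵗT`»: `(A:A) ⊆ (AB:AB)` for `A, B ≠ 0`. [cite: Marseglia2025LocalIsomorphism, §5, proof of Prop. 5.1, p. 10] -/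
theorem div_self_le_mul_div_mul (A B : FractionalIdeal (endOrder (Algebra.leftMulMatrix μ))⁰ K) (hA : A ≠ 0)
    (hB : B ≠ 0) : A / A ≤ A * B / (A * B) := by
  refine (le_div_iff_mul_le (EndOrder.fractionalIdeal_mul_ne_zero hA hB)).2 ?_
  rw [← mul_assoc]
  exact mul_le_mul' ((le_div_iff_mul_le hA).1 le_rfl) le_rfl

omit [Nonempty ι] in
/-- **PROPOSITION 5.1, (2) ⟺ (1): `(IT:IT) = T` for every `I` with `(I:I) = R` ⟺ `(RᵗT:RᵗT) = T`** (⟹: `I = Rᵗ` has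
`(Rᵗ:Rᵗ) = (R:R) = R`; ⟸: `T ⊆ (IT:IT) ⊆ (IT·IᵗT : IT·IᵗT) = (RᵗT:RᵗT) = T`, using `IIᵗ = Rᵗ` for `(I:I) = R`, Lemma 2.3).
[cite: Marseglia2025LocalIsomorphism, §5 Prop. 5.1 ((1) ⟺ (2)), p. 10] [cite: Marseglia2019, §2 Lemma 2.3
(«`S = (I:I) ⟺ IIᵗ = Sᵗ`», «`(I:J) = (Jᵗ:Iᵗ)`»), p. 4] -/
theorem forall_mul_div_mul_eq_iff {M T₁ : FractionalIdeal (endOrder (Algebra.leftMulMatrix μ))⁰ K}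
    (hMM : M * M = M) (hM0 : M ≠ 0)
    (hT₁ : (T₁ : Submodule (endOrder (Algebra.leftMulMatrix μ)) K) =
      traceDual ℤ ℚ ((1 : FractionalIdeal (endOrder (Algebra.leftMulMatrix μ))⁰ K) :
        Submodule (endOrder (Algebra.leftMulMatrix μ)) K)) :
    (∀ I : FractionalIdeal (endOrder (Algebra.leftMulMatrix μ))⁰ K, I ≠ 0 → I / I = 1 → I * M / (I * M) = M) ↔
      T₁ * M / (T₁ * M) = M := by
  have h10 : (1 : FractionalIdeal (endOrder (Algebra.leftMulMatrix μ))⁰ K) ≠ 0 := one_ne_zero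
  obtain ⟨T, hT0, hT⟩ := exists_coe_eq_traceDual μ h10
  have hTT₁ : T = T₁ := coeToSubmodule_inj.1 (hT.trans hT₁.symm)
  subst hTT₁
  constructor
  · -- `(Rᵗ:Rᵗ) = (R:R) = R`
    intro h
    refine h T hT0 ?_
    rw [← div_eq_div_of_coe_eq_traceDual μ h10 h10 hT0 hT hT, FractionalIdeal.div_one]
  · intro h1 I hI hII
    obtain ⟨TI, hTI0, hTI⟩ := exists_coe_eq_traceDual μ hI
    -- `IIᵗ = Rᵗ`
    have hITI : I * TI = T := (div_self_eq_iff_mul_traceDual_eq μ hI hTI0 h10 hTI hT).1 hII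
    have hIM0 : I * M ≠ 0 := EndOrder.fractionalIdeal_mul_ne_zero hI hM0
    have hTIM0 : TI * M ≠ 0 := EndOrder.fractionalIdeal_mul_ne_zero hTI0 hM0
    -- `T ⊆ (IT:IT) ⊆ (IT·IᵗT : IT·IᵗT) = (RᵗT : RᵗT) = T`
    have h2 : M ≤ I * M / (I * M) :=
      (le_div_iff_mul_le hIM0).2 (le_of_eq (by rw [mul_left_comm, hMM]))
    have h3 := div_self_le_mul_div_mul μ (I * M) (TI * M) hIM0 hTIM0
    rw [mul_mul_mul_comm, hITI, hMM, h1] at h3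
    exact le_antisymm h3 h2

/-- **PROPOSITION 5.1, (3) ⟹ (2): if `(R:(R:T)) = T` then `(IT:IT) = T` for every `I` with `(I:I) = R`.**
[cite: Marseglia2025LocalIsomorphism, §5 Prop. 5.1 ((3) ⟹ (1) ⟹ (2)), p. 10] -/
theorem mul_div_mul_eq_of_one_div_one_div_eq {M : FractionalIdeal (endOrder (Algebra.leftMulMatrix μ))⁰ K}
    (hMM : M * M = M) (hM0 : M ≠ 0) (h3 : (1 : FractionalIdeal (endOrder (Algebra.leftMulMatrix μ))⁰ K) / (1 / M) = M)
    {I : FractionalIdeal (endOrder (Algebra.leftMulMatrix μ))⁰ K} (hI : I ≠ 0) (hII : I / I = 1) :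
    I * M / (I * M) = M := by
  have h10 : (1 : FractionalIdeal (endOrder (Algebra.leftMulMatrix μ))⁰ K) ≠ 0 := one_ne_zero
  obtain ⟨T₁, -, hT₁⟩ := exists_coe_eq_traceDual μ h10
  exact (forall_mul_div_mul_eq_iff μ hMM hM0 hT₁).2
    ((mul_div_mul_eq_iff_one_div_one_div_eq μ hMM hM0 hT₁).2 h3) I hI hII

/-- **PROPOSITION 5.2 (in form (2)): for every maximal ideal `𝔭` and every `I` with `(I:I) = R`, the extension
`I·(𝔭:𝔭)` has multiplicator ring exactly `(𝔭:𝔭)`.** [cite: Marseglia2025LocalIsomorphism, §5 Prop. 5.2 with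
Prop. 5.1 ((3) ⟹ (2)), p. 10] -/
theorem mul_div_mul_eq_coeIdeal_div_self (𝔭 : Ideal (endOrder (Algebra.leftMulMatrix μ))) [h𝔭 : 𝔭.IsMaximal]
    {I : FractionalIdeal (endOrder (Algebra.leftMulMatrix μ))⁰ K} (hI : I ≠ 0) (hII : I / I = 1) :
    I * ((𝔭 : FractionalIdeal (endOrder (Algebra.leftMulMatrix μ))⁰ K) / 𝔭) /
        (I * ((𝔭 : FractionalIdeal (endOrder (Algebra.leftMulMatrix μ))⁰ K) / 𝔭)) =
      (𝔭 : FractionalIdeal (endOrder (Algebra.leftMulMatrix μ))⁰ K) / 𝔭 := by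
  have h0 : 𝔭 ≠ ⊥ := Ring.ne_bot_of_isMaximal_of_not_isField h𝔭 EndOrder.not_isField
  have hP0 : (𝔭 : FractionalIdeal (endOrder (Algebra.leftMulMatrix μ))⁰ K) ≠ 0 := coeIdeal_ne_zero.2 h0
  exact mul_div_mul_eq_of_one_div_one_div_eq μ (EndOrder.div_self_mul_div_self hP0) (EndOrder.div_self_ne_zero hP0)
    (EndOrder.one_div_one_div_coeIdeal_div_self 𝔭) hI hII

end CMTypeLattice

end Literature.NumberTheory.ComplexMultiplication
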